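import Summits.HubbardSuperconductivity.HubbardSuperconductivity.Theorems.NodalDiracTwistNodalDiracWeakCouplingOfConicalCore

/-!
# Promotion package, part 2 — the route-vocabulary text IS the registered stub, and the landed glue closes 10370 from it

Crux stmt-HubbardSuperconductivity-10370 `NodalDiracWeakCoupling` (route NodalDiracTwist), line `birth`,
lead c10. `NodalDiracCone` below is byte-identical to the `def` of part 1
(`NodalDiracConeRouteContext.lean`, which elaborates with the route file's imports only). Proved here:

* `nodalDiracCone_iff_stub : NodalDiracCone ↔ (stub_conicalCore statement, verbatim)` — by `Iff.rfl`
  (`spinTwistedHubbardTorus_eq_inline` is `rfl`);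
* `nodalDiracWeakCoupling_of_nodalDiracCone : NodalDiracCone → NodalDiracWeakCoupling` — the landed glue
  `Theorems.NodalDiracTwist.nodalDiracWeakCoupling_of_conicalCore` (p151068) applied through the `rfl`.

So: file `NodalDiracCone` as a route item X; 10370 closes at once by a 3-line Theorems file
`theorem nodalDiracWeakCoupling_proof : NodalDiracWeakCoupling := nodalDiracWeakCoupling_of_conicalCore X_holds`
the moment X is proved, and until then 10370 is exactly as open as X (the two are equivalent up to the
landed mathematics: restriction one way, `conicalQuartet_of_core` + Möbius sign + annulus invariance the other).
-/

set_option linter.dupNamespace false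

noncomputable section

namespace Summit.HubbardSuperconductivity.HubbardSuperconductivity.Cruxes.NodalDiracWeakCoupling.Birth.Promotion

open Literature.MathematicalPhysics.QuantumLattice Literature.Probability.LatticeModels Matrix
open Summit.HubbardSuperconductivity.HubbardSuperconductivity.Theses.NodalDiracTwist
open Summit.HubbardSuperconductivity.HubbardSuperconductivity.Theorems.NodalDiracTwist
open scoped BigOperators ComplexOrder Matrix

/-- Candidate route item `NodalDiracCone` (route vocabulary; byte-identical to part 1). -/
def NodalDiracCone : Prop :=
  ∀ U₀ : ℝ, 0 < U₀ → ∃ U ∈ Set.Ioo (0 : ℝ) U₀, ∃ δ ∈ Set.Icc (1 / 10 : ℝ) (3 / 10), (∃ κ : ℝ, 0 < κ ∧ κ < Real.pi ∧ Real.cos κ ≠ 0 ∧ ∀ ε : ℝ, 0 < ε → ∃ L₀ : ℕ, ∀ (L : ℕ) [NeZero L], Even L → L₀ ≤ L → (∀ m : ℤ, ε ≤ |L * κ - m * Real.pi|) → let sh : Literature.MathematicalPhysics.QuantumLattice.FermionTorus 2 L → Fin 2 → Literature.MathematicalPhysics.QuantumLattice.FermionTorus 2 L := fun x μ => toLex (Function.update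 (ofLex x) μ (ofLex x μ + 1)); let a := fun (x : Literature.MathematicalPhysics.QuantumLattice.FermionTorus 2 L) (σ : Fin 2) => Literature.MathematicalPhysics.QuantumLattice.annihilation (Literature.MathematicalPhysics.QuantumLattice.orb x σ); let H := fun φ : Fin 2 → ℝ => -(∑ x : Literature.MathematicalPhysics.QuantumLattice.FermionTorus 2 L, ∑ μ : Fin 2, ∑ σ : Fin 2, (Complex.exp (Complex.I * (((-1 : ℝ) ^ (σ : ℕ) * φ μ / L : ℝ) : ℂ)) • (Matrix.conjTranspose (a x σ) * a (sh x μ) σ) + Complex.exp (-(Complex.I * (((-1 : ℝ) ^ (σ : ℕ) * φ μ / L : ℝ) : ℂ))) • (Matrix.conjTranspose (a (sh x μ) σ) * a x σ))) + (U : ℂ) • ∑ x : Literature.MathematicalPhysics.QuantumLattice.FermionTorus 2 L, Literature.MathematicalPhysics.QuantumLattice.numberOp x 0 * Literature.MathematicalPhysics.QuantumLattice.numberOp x 1; ∃ c : ℝ, 0 < c ∧ c < Real.pi ∧ |Real.cos c - Real.cos (L * κ)| ≤ ε ∧ (∀ φ : Fin 2 → ℝ, 0 ≤ φ 1 → φ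 1 ≤ φ 0 → φ 0 ≤ Real.pi → ((∃ ψ₁ ψ₂ : Literature.MathematicalPhysics.QuantumLattice.Fock (Literature.MathematicalPhysics.QuantumLattice.Orb (Literature.MathematicalPhysics.QuantumLattice.FermionTorus 2 L)), Literature.MathematicalPhysics.QuantumLattice.IsGroundStateInSector (H φ) (2 * ⌊(1 - δ) * (L : ℝ) ^ 2 / 2⌋₊) 0 ψ₁ ∧ Literature.MathematicalPhysics.QuantumLattice.IsGroundStateInSector (H φ) (2 * ⌊(1 - δ) * (L : ℝ) ^ 2 / 2⌋₊) 0 ψ₂ ∧ star ψ₁ ⬝ᵥ ψ₂ = 0) ↔ (φ 0 = c ∧ φ 1 = c))) ∧ (∃ ψ₁ ψ₂ : Literature.MathematicalPhysics.QuantumLattice.Fock (Literature.MathematicalPhysics.QuantumLattice.Orb (Literature.MathematicalPhysics.QuantumLattice.FermionTorus 2 L)), Literature.MathematicalPhysics.QuantumLattice.IsGroundStateInSector (H (fun _ : Fin 2 => c)) (2 * ⌊(1 - δ) * (L : ℝ) ^ 2 / 2⌋₊) 0 ψ₁ ∧ Literature.MathematicalPhysics.QuantumLattice.IsGroundStateInSector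 (H (fun _ : Fin 2 => c)) (2 * ⌊(1 - δ) * (L : ℝ) ^ 2 / 2⌋₊) 0 ψ₂ ∧ star ψ₁ ⬝ᵥ ψ₂ = 0 ∧ ∀ χ : Literature.MathematicalPhysics.QuantumLattice.Fock (Literature.MathematicalPhysics.QuantumLattice.Orb (Literature.MathematicalPhysics.QuantumLattice.FermionTorus 2 L)), Literature.MathematicalPhysics.QuantumLattice.IsGroundStateInSector (H (fun _ : Fin 2 => c)) (2 * ⌊(1 - δ) * (L : ℝ) ^ 2 / 2⌋₊) 0 χ → ∃ z₁ z₂ : ℂ, χ = z₁ • ψ₁ + z₂ • ψ₂) ∧ (∃ m : ℝ, 0 < m ∧ ∃ ρ : ℝ, 0 < ρ ∧ ∀ φ : Fin 2 → ℝ, 0 < (φ 0 - c) ^ 2 + (φ 1 - c) ^ 2 → (φ 0 - c) ^ 2 + (φ 1 - c) ^ 2 ≤ ρ ^ 2 → ∀ ψ χ : Literature.MathematicalPhysics.QuantumLattice.Fock (Literature.MathematicalPhysics.QuantumLattice.Orb (Literature.MathematicalPhysics.QuantumLattice.FermionTorus 2 L)), Literature.MathematicalPhysics.QuantumLattice.IsGroundStateInSector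 (H φ) (2 * ⌊(1 - δ) * (L : ℝ) ^ 2 / 2⌋₊) 0 ψ → χ ∈ Literature.MathematicalPhysics.QuantumLattice.szSector (2 * ⌊(1 - δ) * (L : ℝ) ^ 2 / 2⌋₊) 0 → star ψ ⬝ᵥ χ = 0 → star χ ⬝ᵥ χ = 1 → Matrix.minEnergyOn (H φ) (Literature.MathematicalPhysics.QuantumLattice.szSector (2 * ⌊(1 - δ) * (L : ℝ) ^ 2 / 2⌋₊) 0) + m * Real.sqrt ((φ 0 - c) ^ 2 + (φ 1 - c) ^ 2) ≤ (star χ ⬝ᵥ (H φ *ᵥ χ)).re))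

/-- The route-vocabulary text is DEFINITIONALLY the registered stub `stub_conicalCore` of
`Cruxes/NodalDiracWeakCoupling/Lines/birth.lean` (v7, sha 489e32be). -/
theorem nodalDiracCone_iff_stub :
    NodalDiracCone ↔
    (    ∀ U₀ : ℝ, 0 < U₀ → ∃ U ∈ Set.Ioo (0 : ℝ) U₀, ∃ δ ∈ Set.Icc (1 / 10 : ℝ) (3 / 10),
      ∃ κ : ℝ, 0 < κ ∧ κ < Real.pi ∧ Real.cos κ ≠ 0 ∧ ∀ ε : ℝ, 0 < ε → ∃ L₀ : ℕ,
        ∀ (L : ℕ) [NeZero L], Even L → L₀ ≤ L → (∀ m : ℤ, ε ≤ |L * κ - m * Real.pi|) →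
          ∃ c : ℝ, 0 < c ∧ c < Real.pi ∧ |Real.cos c - Real.cos (L * κ)| ≤ ε ∧
            (∀ φ : Fin 2 → ℝ, 0 ≤ φ 1 → φ 1 ≤ φ 0 → φ 0 ≤ Real.pi →
                ((∃ ψ₁ ψ₂ : Fock (Orb (FermionTorus 2 L)),
                    IsGroundStateInSector (spinTwistedHubbardTorus L U φ) (2 * ⌊(1 - δ) * (L : ℝ) ^ 2 / 2⌋₊) 0 ψ₁ ∧
                    IsGroundStateInSector (spinTwistedHubbardTorus L U φ) (2 * ⌊(1 - δ) * (L : ℝ) ^ 2 / 2⌋₊) 0 ψ₂ ∧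
                    star ψ₁ ⬝ᵥ ψ₂ = 0) ↔ (φ 0 = c ∧ φ 1 = c))) ∧
            (∃ ψ₁ ψ₂ : Fock (Orb (FermionTorus 2 L)),
                IsGroundStateInSector (spinTwistedHubbardTorus L U (fun _ : Fin 2 => c)) (2 * ⌊(1 - δ) * (L : ℝ) ^ 2 / 2⌋₊) 0 ψ₁ ∧
                IsGroundStateInSector (spinTwistedHubbardTorus L U (fun _ : Fin 2 => c)) (2 * ⌊(1 - δ) * (L : ℝ) ^ 2 / 2⌋₊) 0 ψ₂ ∧
                star ψ₁ ⬝ᵥ ψ₂ = 0 ∧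
                ∀ χ : Fock (Orb (FermionTorus 2 L)),
                  IsGroundStateInSector (spinTwistedHubbardTorus L U (fun _ : Fin 2 => c)) (2 * ⌊(1 - δ) * (L : ℝ) ^ 2 / 2⌋₊) 0 χ →
                    ∃ z₁ z₂ : ℂ, χ = z₁ • ψ₁ + z₂ • ψ₂) ∧
            (∃ m : ℝ, 0 < m ∧ ∃ ρ : ℝ, 0 < ρ ∧ ∀ φ : Fin 2 → ℝ,
                0 < (φ 0 - c) ^ 2 + (φ 1 - c) ^ 2 →
                (φ 0 - c) ^ 2 + (φ 1 - c) ^ 2 ≤ ρ ^ 2 →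
                ∀ ψ χ : Fock (Orb (FermionTorus 2 L)),
                  IsGroundStateInSector (spinTwistedHubbardTorus L U φ) (2 * ⌊(1 - δ) * (L : ℝ) ^ 2 / 2⌋₊) 0 ψ →
                  χ ∈ szSector (2 * ⌊(1 - δ) * (L : ℝ) ^ 2 / 2⌋₊) 0 → star ψ ⬝ᵥ χ = 0 → star χ ⬝ᵥ χ = 1 →
                    Matrix.minEnergyOn (spinTwistedHubbardTorus L U φ) (szSector (2 * ⌊(1 - δ) * (L : ℝ) ^ 2 / 2⌋₊) 0) +
                        m * Real.sqrt ((φ 0 - c) ^ 2 + (φ 1 - c) ^ 2) ≤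
                      (star χ ⬝ᵥ (spinTwistedHubbardTorus L U φ *ᵥ χ)).re)) :=
  Iff.rfl

/-- **Promotion closes 10370.** The candidate item implies the crux `NodalDiracWeakCoupling` BY NAME,
through the landed glue `nodalDiracWeakCoupling_of_conicalCore` (p151068). -/
theorem nodalDiracWeakCoupling_of_nodalDiracCone (h : NodalDiracCone) : NodalDiracWeakCoupling :=
  nodalDiracWeakCoupling_of_conicalCore (nodalDiracCone_iff_stub.1 h)

end Summit.HubbardSuperconductivity.HubbardSuperconductivity.Cruxes.NodalDiracWeakCoupling.Birth.Promotion

end
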